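import Mathlib.Analysis.SpecialFunctions.Pow.Real
import Mathlib.Algebra.MvPolynomial.Degrees
import Literature.Computability.AlgebraicComplexity.NarayananElusive
import HarnessLib

/-!
# Narayanan's doubling curve: Remark 1 (not `(m−1, 2)`-elusive) and the route form of Theorem 1

Topic `Literature/Computability/AlgebraicComplexity`. Companion (proofs only, no new named
facts) to `NarayananElusive.lean`, which records A. K. Narayanan, *Arithmetic circuit lower
bounds from sumset expansion* (arXiv:2607.15848, 2026), Theorem 1 as the named fact
`Narayanan2026_thm1` for the doubling curve `doublingCurve m = (X₀^{2^i})_{i<m}` and deliberately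
leaves out Remark 1. Here:

* `not_isElusive_doublingCurve` — **Remark 1** (p. 9), PROVED: for `m ≥ 2` the doubling curve
  `z ↦ (z, z², z⁴, …, z^{2^{m−1}})` is not `(m − 1, 2)`-elusive, its image lying in the image of
  the degree-`2` map `(z₁, …, z_{m−1}) ↦ (z₁, z₁², z₂, …, z_{m−1})` ("take `z₁ = z`,
  `z_j = z^{2^j}`"). Negative knowledge at `s = m − 1` next to the tree's
  `Summit.ValiantsHypothesis.Elusive.not_isElusive_momentCurve` and route GirthSidon's support
  `….GirthSidon.LowMonomialCurvesSwallowed` (which covers heights `D` with `m((m−1)D+1) < 2^{m−1}`;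
  the doubling curve, of height `2^{m−1}`, is outside that range and is swallowed anyway).
* `Narayanan2026_thm1.isElusive_of_pow_le` — Theorem 1 in the arithmetic form used by route
  GirthSidon (`∀ s, s^{10} ≤ m^9 → (s, 2)`-elusive, the binders of
  `….GirthSidon.MomentCurveElusive`), PROVED from the fact by antitonicity in `s`
  (`IsElusive.anti_left`) and `le_floor_rpow_of_pow_le : s^{10} ≤ m^9 → s ≤ ⌊m^{9/10}⌋₊`.

## References

* [Narayanan2026] A. K. Narayanan, arXiv:2607.15848 (2026): Theorem 1 (§1.2, p. 2), Remark 1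
  (§2, p. 9: "`f(ℂ)` is contained in the image of `(z₁, …, z_{m−1}) ↦ (z₁, …, z_i, z_i², z_{i+1},
  …, z_{m−1})`, implying `f` is not `(m−1, 2)`-elusive"). Held text `paper:arxiv-2607.15848`.
* [Raz2010] R. Raz, Theory of Computing 6 (2010), Def. 1.1 (`IsElusive`).
-/

noncomputable section

namespace Literature.Computability.AlgebraicComplexity

open MvPolynomial

/-- `s^{10} ≤ m^9` in `ℕ` implies `s ≤ ⌊m^{9/10}⌋` (real `9/10`-th power). [folklore] -/
theorem le_floor_rpow_of_pow_le {s m : ℕ} (h : s ^ 10 ≤ m ^ 9) :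
    s ≤ ⌊(m : ℝ) ^ ((9 : ℝ) / 10)⌋₊ := by
  refine Nat.le_floor ?_
  have hs : (0 : ℝ) ≤ s := Nat.cast_nonneg s
  have hm : (0 : ℝ) ≤ m := Nat.cast_nonneg m
  have h' : ((s : ℝ) ^ (10 : ℕ)) ≤ ((m : ℝ) ^ (9 : ℕ)) := by exact_mod_cast h
  have key : ((s : ℝ) ^ (10 : ℕ)) ^ ((10 : ℝ)⁻¹) ≤ ((m : ℝ) ^ (9 : ℕ)) ^ ((10 : ℝ)⁻¹) :=
    Real.rpow_le_rpow (pow_nonneg hs _) h' (by norm_num)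
  have lhs : ((s : ℝ) ^ (10 : ℕ)) ^ ((10 : ℝ)⁻¹) = s :=
    Real.pow_rpow_inv_natCast hs (by norm_num)
  have rhs : ((m : ℝ) ^ (9 : ℕ)) ^ ((10 : ℝ)⁻¹) = (m : ℝ) ^ ((9 : ℝ) / 10) := by
    rw [← Real.rpow_natCast (m : ℝ) 9, ← Real.rpow_mul hm]
    norm_num
  rwa [lhs, rhs] at key

/-- **Narayanan 2026, Theorem 1, in route GirthSidon's arithmetic form**: for large `m` the
doubling curve is `(s, 2)`-elusive for EVERY `s` with `s^{10} ≤ m^9` — equivalent to the printed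
`s = ⌊m^{9/10}⌋` by antitonicity of elusiveness in `s` (`IsElusive.anti_left`). Proved from the
named fact `Narayanan2026_thm1`. [cite: Narayanan2026, Thm. 1] -/
theorem Narayanan2026_thm1.isElusive_of_pow_le (h : Narayanan2026_thm1) :
    ∃ m₀ : ℕ, ∀ m ≥ m₀, ∀ s : ℕ, s ^ 10 ≤ m ^ 9 → IsElusive (doublingCurve m) s 2 := by
  obtain ⟨m₀, hm₀⟩ := h
  exact ⟨m₀, fun m hm s hs => (hm₀ m hm).anti_left (le_floor_rpow_of_pow_le hs)⟩

/-- **Narayanan 2026, Remark 1** (proved): for `m ≥ 2` the doubling curve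
`z ↦ (z, z², z⁴, …, z^{2^{m−1}})` is NOT `(m − 1, 2)`-elusive — its image is contained in the
image of the degree-`2` map `(y₀, …, y_{m−2}) ↦ (y₀, y₀², y₁, …, y_{m−2})` (along the curve put
`y₀ = z`, `y_j = z^{2^{j+1}}` for `j ≥ 1`). (`m ≥ 2` is needed: for `m = 1` a point `ℂ⁰` does not
cover the line.) [cite: Narayanan2026, Rem. 1] -/
theorem not_isElusive_doublingCurve (m : ℕ) (hm : 2 ≤ m) :
    ¬ IsElusive (doublingCurve m) (m - 1) 2 := by
  intro h
  refine h (fun i => if (i : ℕ) = 0 then X ⟨0, by omega⟩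
      else if (i : ℕ) = 1 then X ⟨0, by omega⟩ ^ 2
      else X ⟨(i : ℕ) - 1, by have := i.2; omega⟩) (fun i => ?_) ?_
  · split_ifs
    · rw [totalDegree_X]; norm_num
    · rw [totalDegree_X_pow]
    · rw [totalDegree_X]; norm_num
  · rintro _ ⟨x, rfl⟩
    refine ⟨fun j => if (j : ℕ) = 0 then x 0 else x 0 ^ 2 ^ ((j : ℕ) + 1), funext fun i => ?_⟩
    simp only [polyMapEval_apply, doublingCurve, map_pow, eval_X]
    split_ifs with h0 h1
    · simp [h0]
    · simp [h1]
    · have hi : (i : ℕ) - 1 ≠ 0 := by omega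
      have hi' : (i : ℕ) - 1 + 1 = i := by omega
      simp [hi, hi']

end Literature.Computability.AlgebraicComplexity

end
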